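import Summits.Ventures.PercRepro.C025ProfileOneFlatTypes
import Summits.Ventures.PercRepro.C025ProfileOneFlatModel

/-!
# THE SECOND ROW OF (Π) ON «`U_{r,n}` WITH ONE FAT FLAT», EVERY SIZE — AND C-025 AT `(r, r−2)` THERE (night-3 g24)

`proofs/NIGHT3-G24-ONEFLAT.md` §8.  night-1's `modelMatroid hE F s r = T_r(U_{s,F} ⊕ U_{E∖F,E∖F})` (`k = #F ≥ s ≥ 1`,
`s + 1 ≤ r ≤ s + m`, `m = #(E ∖ F)`): for every `q ≤ r − 2` the row `(q, r−1)` of (Π) holds — in the spanning regime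
`r + q ≤ s + m` by `profileIneq_second_modelMatroid`, and for `r + q > s + m` (`τ ≥ 1`) by the TYPE INEQUALITY
`OneFlat.type_ineq`: a member with `i` fat points has complement rank `min(r, σ_i + r − τ)` (`σ_i = min(k−i,s) + min(i,s) − s`),
hence price `r/(q+1)`, `1` or `0` according to `τ ≤ σ_i`, `σ_i + 1 = τ`, `σ_i + 1 < τ` (`price_eq_weight`); the members of each
type inject into (`i`-subsets of `F`) × (`(q−min(i,s))`-subsets of `E ∖ F`), and the products (`i`-subsets) × (`(r−1−min(i,s))`-subsets)
inject into the level `r − 1`.  So g23's first open family is CLOSED for every `s, k, m, r, q`: **C-025 at the corank-2 diagonal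
`(r, r−2)` on every «`U_{r,n}` with one fat flat `U_{s,k}`», every `n`** (`rls_modelMatroid_all`).
No `def`, no `instance`, no notation.  Axioms: standard.
-/

open scoped Matroid

namespace PercRepro

open Finset ThmH

namespace OneFlat

variable {α : Type} [DecidableEq α]

open Classical in
/-- The rank formula of night-1's model in the `Finset` vocabulary, for the split `E₁ = {x ∈ gr M | x ∈ F}`, `E₂ = {x ∈ gr M | x ∉ F}`. -/
theorem modelMatroid_eRk_finset {E : Set α} (hE : E.Finite) {F : Set α} (hF : F ⊆ E) {s r : ℕ} (hsr : s ≤ r)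
    (X : Finset α) :
    haveI := modelMatroid_finite hE F s r
    X ⊆ gr (modelMatroid hE F s r) →
    (modelMatroid hE F s r).eRk (X : Set α) =
      ((min r (min (X ∩ (gr (modelMatroid hE F s r)).filter (fun x => x ∈ F)).card s +
        (X ∩ (gr (modelMatroid hE F s r)).filter (fun x => x ∉ F)).card) : ℕ) : ℕ∞) := by
  classical
  haveI := modelMatroid_finite hE F s r
  intro hX
  have hgr : ((gr (modelMatroid hE F s r) : Finset α) : Set α) = E := by
    rw [coe_gr, modelMatroid_E]
  have hE₁coe : (((gr (modelMatroid hE F s r)).filter (fun x => x ∈ F) : Finset α) : Set α) = F := by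
    ext x
    simp only [coe_filter, Set.mem_setOf_eq]
    constructor
    · exact fun h => h.2
    · intro hx
      refine ⟨?_, hx⟩
      rw [← mem_coe, hgr]
      exact hF hx
  have hE₂coe : (((gr (modelMatroid hE F s r)).filter (fun x => x ∉ F) : Finset α) : Set α) = E \ F := by
    ext x
    simp only [coe_filter, Set.mem_setOf_eq, Set.mem_sdiff]
    rw [← mem_coe, hgr]
  have hXE : (X : Set α) ⊆ E := by rw [← hgr]; exact_mod_cast hX
  rw [modelMatroid_eRk hE F hsr hXE]
  congr 1
  have h1 : ((X : Set α) ∩ F).ncard = (X ∩ (gr (modelMatroid hE F s r)).filter (fun x => x ∈ F)).card := by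
    rw [← Set.ncard_coe_finset, coe_inter, hE₁coe]
  have h2 : ((X : Set α) \ F).ncard = (X ∩ (gr (modelMatroid hE F s r)).filter (fun x => x ∉ F)).card := by
    rw [← Set.ncard_coe_finset, coe_inter, hE₂coe]
    congr 1
    ext x
    simp only [Set.mem_sdiff, Set.mem_inter_iff]
    constructor
    · exact fun h => ⟨h.1, hXE h.1, h.2⟩
    · exact fun h => ⟨h.1, h.2.2⟩
  rw [h1, h2, min_comm]

section Split

variable (M : Matroid α) [M.Finite] (E₁ E₂ : Finset α) (s r : ℕ)

omit [DecidableEq α] in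
/-- `σ_i = min(k−i,s) + min(i,s) − s` is a genuine natural number: `s ≤ min(k−i,s) + min(i,s)` for `i ≤ k`, `s ≤ k`. -/
theorem le_sigma {k s i : ℕ} (hsk : s ≤ k) (hi : i ≤ k) : s ≤ min (k - i) s + min i s := by
  rcases le_total i s with h | h
  · rcases le_total (k - i) s with h' | h'
    · rw [min_eq_left h', min_eq_left h]; omega
    · rw [min_eq_right h']; omega
  · rw [min_eq_right h]; omega

/-- The rank of the complement of a rank-`q` set with `i` fat points: `min(r, σ_i + (r − τ))`, `σ_i = min(k−i,s) + min(i,s) − s`,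
when `|E₂| + s + τ = r + q` and `τ ≤ r`. -/
theorem eRk_compl_of_mem_Rq (hE : gr M = E₁ ∪ E₂) (hsk : s ≤ E₁.card)
    (hrk : ∀ X : Finset α, X ⊆ gr M →
      M.eRk (X : Set α) = ((min r (min (X ∩ E₁).card s + (X ∩ E₂).card) : ℕ) : ℕ∞))
    {q τ : ℕ} (hm : E₂.card + s + τ = r + q) (hτr : τ ≤ r) {B : Finset α} (hB : B ∈ Profile.Rq M q) (hqr : q < r) :
    M.eRk ((gr M \ B : Finset α) : Set α) =
      ((min r (min (E₁.card - (B ∩ E₁).card) s + min (B ∩ E₁).card s - s + (r - τ)) : ℕ) : ℕ∞) := by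
  rw [Profile.mem_Rq] at hB
  obtain ⟨hBg, hBq⟩ := hB
  rw [hrk B hBg] at hBq
  have hBq' : min r (min (B ∩ E₁).card s + (B ∩ E₂).card) = q := by exact_mod_cast hBq
  have hmem : min (B ∩ E₁).card s + (B ∩ E₂).card = q := by omega
  have hE₁g : E₁ ⊆ gr M := by rw [hE]; exact subset_union_left
  have hE₂g : E₂ ⊆ gr M := by rw [hE]; exact subset_union_right
  have hc₁ : ((gr M \ B) ∩ E₁).card = E₁.card - (B ∩ E₁).card := by
    have : (gr M \ B) ∩ E₁ = E₁ \ B := by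
      ext x; simp only [mem_inter, mem_sdiff]
      constructor
      · exact fun h => ⟨h.2, h.1.2⟩
      · exact fun h => ⟨⟨hE₁g h.1, h.2⟩, h.1⟩
    rw [this, card_sdiff]
  have hc₂ : ((gr M \ B) ∩ E₂).card = E₂.card - (B ∩ E₂).card := by
    have : (gr M \ B) ∩ E₂ = E₂ \ B := by
      ext x; simp only [mem_inter, mem_sdiff]
      constructor
      · exact fun h => ⟨h.2, h.1.2⟩
      · exact fun h => ⟨⟨hE₂g h.1, h.2⟩, h.1⟩
    rw [this, card_sdiff]
  have hBE₂ : (B ∩ E₂).card ≤ E₂.card := card_le_card inter_subset_right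
  have hBE₁ : (B ∩ E₁).card ≤ E₁.card := card_le_card inter_subset_right
  have hσ := le_sigma (k := E₁.card) (s := s) (i := (B ∩ E₁).card) hsk hBE₁
  rw [hrk (gr M \ B) sdiff_subset, hc₁, hc₂]
  congr 2
  -- `min(k−i,s) + (m − |B∩E₂|) = (min(k−i,s) + min(i,s) − s) + (r − τ)`, using `|B∩E₂| = q − min(i,s)` and `m + s + τ = r + q`
  omega

/-- The price of a rank-`q` set with `i` fat points equals the weight of its type: `r/(q+1)` if `τ ≤ σ_i`, `1` if `σ_i + 1 = τ`,
`0` otherwise. -/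
theorem price_eq_weight (hE : gr M = E₁ ∪ E₂) (hsk : s ≤ E₁.card)
    (hrk : ∀ X : Finset α, X ⊆ gr M →
      M.eRk (X : Set α) = ((min r (min (X ∩ E₁).card s + (X ∩ E₂).card) : ℕ) : ℕ∞))
    {q τ : ℕ} (hm : E₂.card + s + τ = r + q) (hτr : τ ≤ r) (hq : q + 2 ≤ r) {B : Finset α} (hB : B ∈ Profile.Rq M q) :
    Profile.price M q (r - 1) B =
      (if τ ≤ min (E₁.card - (B ∩ E₁).card) s + min (B ∩ E₁).card s - s then (r : ℚ) / ((q : ℚ) + 1)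
        else if min (E₁.card - (B ∩ E₁).card) s + min (B ∩ E₁).card s - s + 1 = τ then 1 else 0) := by
  have hp := eRk_compl_of_mem_Rq M E₁ E₂ s r hE hsk hrk hm hτr hB (by omega)
  set σ := min (E₁.card - (B ∩ E₁).card) s + min (B ∩ E₁).card s - s with hσ
  by_cases h1 : τ ≤ σ
  · rw [if_pos h1]
    have hpr : min r (σ + (r - τ)) = r := min_eq_left (by omega)
    rw [hpr] at hp
    rw [PriceMono.price_eq_of_le hp (by omega), choose_div_choose_tight (by omega)]
  · rw [if_neg h1]
    by_cases h2 : σ + 1 = τ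
    · rw [if_pos h2]
      have hpr : min r (σ + (r - τ)) = r - 1 := by rw [min_eq_right (by omega)]; omega
      rw [hpr] at hp
      rw [PriceMono.price_eq_of_le hp le_rfl]
      have hpos : (0 : ℚ) < ((r - 1 + q).choose q : ℚ) := by exact_mod_cast Nat.choose_pos (by omega)
      rw [div_eq_one_iff_eq hpos.ne']
      congr 1
      exact Nat.choose_symm_add
    · rw [if_neg h2]
      have hpr : min r (σ + (r - τ)) = σ + (r - τ) := min_eq_right (by omega)
      rw [hpr] at hp
      unfold Profile.price
      rw [hp, if_neg]
      intro hcon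
      have : r - 1 ≤ σ + (r - τ) := by exact_mod_cast hcon
      omega

/-- The members with `i` fat points number at most `C(k,i)·C(m, q − min(i,s))` (`[min(i,s) ≤ q]`). -/
theorem card_Rq_fat_le (hE : gr M = E₁ ∪ E₂)
    (hrk : ∀ X : Finset α, X ⊆ gr M →
      M.eRk (X : Set α) = ((min r (min (X ∩ E₁).card s + (X ∩ E₂).card) : ℕ) : ℕ∞))
    (q : ℕ) (hqr : q < r) (i : ℕ) :
    (((Profile.Rq M q).filter (fun B => (B ∩ E₁).card = i)).card : ℚ) ≤
      (E₁.card.choose i : ℚ) * (if min i s ≤ q then ((E₂.card).choose (q - min i s) : ℚ) else 0) := by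
  by_cases hc : min i s ≤ q
  · rw [if_pos hc]
    have : ((Profile.Rq M q).filter (fun B => (B ∩ E₁).card = i)).card ≤
        E₁.card.choose i * (E₂.card).choose (q - min i s) := by
      rw [← card_powersetCard, ← card_powersetCard, ← card_product]
      apply card_le_card_of_injOn (fun B => (B ∩ E₁, B ∩ E₂))
      · intro B hB
        simp only [coe_filter, Set.mem_setOf_eq, Profile.mem_Rq] at hB
        obtain ⟨⟨hBg, hBq⟩, hBi⟩ := hB
        rw [hrk B hBg] at hBq
        have hBq' : min r (min (B ∩ E₁).card s + (B ∩ E₂).card) = q := by exact_mod_cast hBq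
        simp only [coe_product, Set.mem_prod, mem_coe, mem_powersetCard]
        refine ⟨⟨inter_subset_right, hBi⟩, inter_subset_right, ?_⟩
        rw [← hBi]; omega
      · intro B hB B' hB' hBB'
        simp only [coe_filter, Set.mem_setOf_eq, Profile.mem_Rq] at hB hB'
        simp only [Prod.mk.injEq] at hBB'
        have h1 : B = B ∩ E₁ ∪ B ∩ E₂ := by
          rw [← inter_union_distrib_left, ← hE]
          exact (inter_eq_left.2 hB.1.1).symm
        have h2 : B' = B' ∩ E₁ ∪ B' ∩ E₂ := by
          rw [← inter_union_distrib_left, ← hE]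
          exact (inter_eq_left.2 hB'.1.1).symm
        rw [h1, h2, hBB'.1, hBB'.2]
    exact_mod_cast this
  · rw [if_neg hc, mul_zero]
    -- no member has `min(i,s) > q`
    have : (Profile.Rq M q).filter (fun B => (B ∩ E₁).card = i) = ∅ := by
      rw [filter_eq_empty_iff]
      intro B hB hBi
      rw [Profile.mem_Rq] at hB
      have hBq := hB.2
      rw [hrk B hB.1] at hBq
      have hBq' : min r (min (B ∩ E₁).card s + (B ∩ E₂).card) = q := by exact_mod_cast hBq
      rw [hBi] at hBq'
      omega
    rw [this, card_empty]; simp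

/-- (`i`-subsets of `E₁`) × (`(r−1−min(i,s))`-subsets of `E₂`) inject by union into the level `r − 1`, fibre `|S ∩ E₁| = i`. -/
theorem card_levelSet_fat_ge (hE : gr M = E₁ ∪ E₂) (hdisj : Disjoint E₁ E₂)
    (hrk : ∀ X : Finset α, X ⊆ gr M →
      M.eRk (X : Set α) = ((min r (min (X ∩ E₁).card s + (X ∩ E₂).card) : ℕ) : ℕ∞))
    (hsr : s + 1 ≤ r) (i : ℕ) :
    E₁.card.choose i * (E₂.card).choose (r - 1 - min i s) ≤
      ((Shadow.levelSet M (r - 1)).filter (fun S => (S ∩ E₁).card = i)).card := by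
  have e1 : ∀ (Y Z : Finset α), Y ⊆ E₁ → Z ⊆ E₂ → (Y ∪ Z) ∩ E₁ = Y := by
    intro Y Z hY hZ
    rw [union_inter_distrib_right, inter_eq_left.2 hY,
      disjoint_iff_inter_eq_empty.1 (disjoint_of_subset_left hZ hdisj.symm), union_empty]
  have e2 : ∀ (Y Z : Finset α), Y ⊆ E₁ → Z ⊆ E₂ → (Y ∪ Z) ∩ E₂ = Z := by
    intro Y Z hY hZ
    rw [union_inter_distrib_right, inter_eq_left.2 hZ,
      disjoint_iff_inter_eq_empty.1 (disjoint_of_subset_left hY hdisj), empty_union]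
  rw [← card_powersetCard, ← card_powersetCard, ← card_product]
  apply card_le_card_of_injOn (fun YZ : Finset α × Finset α => YZ.1 ∪ YZ.2)
  · rintro ⟨Y, Z⟩ hYZ
    simp only [coe_product, Set.mem_prod, mem_coe, mem_powersetCard] at hYZ
    obtain ⟨⟨hY, hYc⟩, hZ, hZc⟩ := hYZ
    have hsub : Y ∪ Z ⊆ gr M := by
      rw [hE]; exact union_subset_union hY hZ
    simp only [coe_filter, Set.mem_setOf_eq, Profile.mem_levelSet]
    refine ⟨⟨hsub, ?_⟩, by rw [e1 Y Z hY hZ]; exact hYc⟩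
    rw [hrk (Y ∪ Z) hsub, e1 Y Z hY hZ, e2 Y Z hY hZ, hYc, hZc]
    congr 1
    have : min i s ≤ s := min_le_right _ _
    omega
  · rintro ⟨Y, Z⟩ hYZ ⟨Y', Z'⟩ hYZ' h
    simp only [coe_product, Set.mem_prod, mem_coe, mem_powersetCard] at hYZ hYZ'
    simp only at h
    have hY : Y = Y' := by
      rw [← e1 Y Z hYZ.1.1 hYZ.2.1, ← e1 Y' Z' hYZ'.1.1 hYZ'.2.1, h]
    have hZ : Z = Z' := by
      rw [← e2 Y Z hYZ.1.1 hYZ.2.1, ← e2 Y' Z' hYZ'.1.1 hYZ'.2.1, h]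
    rw [hY, hZ]

/-- **THE SECOND ROW AT `τ ≥ 1` ON A UNIFORM FLAT, SPLIT FORM**: `M` finite, `gr M = E₁ ⊔ E₂`, the rank function
`min(r, min(|X ∩ E₁|, s) + |X ∩ E₂|)`, `1 ≤ s ≤ |E₁|`, `s + 1 ≤ r ≤ s + |E₂|`, `q + 2 ≤ r`, `|E₂| + s + τ = r + q` with `1 ≤ τ`. -/
theorem profileIneq_second_uniformFlat_tau (hE : gr M = E₁ ∪ E₂) (hdisj : Disjoint E₁ E₂)
    (hrk : ∀ X : Finset α, X ⊆ gr M →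
      M.eRk (X : Set α) = ((min r (min (X ∩ E₁).card s + (X ∩ E₂).card) : ℕ) : ℕ∞))
    (hs : 1 ≤ s) (hsk : s ≤ E₁.card) (hsr : s + 1 ≤ r) (hrm : r ≤ s + E₂.card) {q τ : ℕ} (hq : q + 2 ≤ r)
    (hm : E₂.card + s + τ = r + q) (hτ : 1 ≤ τ) :
    Profile.ProfileIneq M q (r - 1) := by
  unfold Profile.ProfileIneq
  set k := E₁.card with hk
  set m := E₂.card with hmdef
  have hτr : τ ≤ r := by omega
  -- (a) the members, fibred by the number of fat points
  have hmaps : ∀ B ∈ Profile.Rq M q, (B ∩ E₁).card ∈ range (k + 1) := by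
    intro B _
    rw [mem_range, Nat.lt_succ_iff]
    exact card_le_card inter_subset_right
  have hA : ∑ B ∈ Profile.Rq M q, Profile.price M q (r - 1) B ≤
      ∑ i ∈ range (k + 1), (k.choose i : ℚ) * (if min i s ≤ q then (m.choose (q - min i s) : ℚ) else 0) *
        (if τ ≤ min (k - i) s + min i s - s then (r : ℚ) / ((q : ℚ) + 1)
          else if min (k - i) s + min i s - s + 1 = τ then 1 else 0) := by
    rw [← sum_fiberwise_of_maps_to hmaps]
    apply sum_le_sum
    intro i _
    -- every member of the fibre has the weight of type `i`
    have hw : ∀ B ∈ (Profile.Rq M q).filter (fun B => (B ∩ E₁).card = i),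
        Profile.price M q (r - 1) B =
          (if τ ≤ min (k - i) s + min i s - s then (r : ℚ) / ((q : ℚ) + 1)
            else if min (k - i) s + min i s - s + 1 = τ then 1 else 0) := by
      intro B hB
      rw [mem_filter] at hB
      rw [price_eq_weight M E₁ E₂ s r hE hsk hrk hm hτr hq hB.1, hB.2]
    rw [sum_congr rfl hw, sum_const, nsmul_eq_mul]
    have hwnn : (0 : ℚ) ≤ (if τ ≤ min (k - i) s + min i s - s then (r : ℚ) / ((q : ℚ) + 1)
          else if min (k - i) s + min i s - s + 1 = τ then 1 else 0) := by
      split_ifs <;> positivity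
    exact mul_le_mul_of_nonneg_right (card_Rq_fat_le M E₁ E₂ s r hE hrk q (by omega) i) hwnn
  -- (b) the level `r − 1`, fibred by the number of fat points
  have hmaps' : ∀ S ∈ Shadow.levelSet M (r - 1), (S ∩ E₁).card ∈ range (k + 1) := by
    intro S _
    rw [mem_range, Nat.lt_succ_iff]
    exact card_le_card inter_subset_right
  have hC : ∑ i ∈ range (k + 1), (k.choose i : ℚ) * (m.choose (r - 1 - min i s) : ℚ) ≤
      ((Shadow.levelSet M (r - 1)).card : ℚ) := by
    rw [card_eq_sum_card_fiberwise (fun S hS => mem_coe.2 (hmaps' S (mem_coe.1 hS)))]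
    push_cast
    apply sum_le_sum
    intro i _
    exact_mod_cast card_levelSet_fat_ge M E₁ E₂ s r hE hdisj hrk hsr i
  -- (c) the type inequality
  have hT := type_ineq (s := s) (k := k) (r := r) (q := q) (m := m) (τ := τ) hs hsk hm hτ hsr hrm hq
  linarith [hA, hC, hT]

end Split

/-- **THE SECOND ROW `(q, r−1)` OF (Π) ON night-1's MODEL `T_r(U_{s,F} ⊕ U_{E∖F,E∖F}) FOR EVERY SIZE**: `1 ≤ s ≤ #F`,
`s + 1 ≤ r ≤ s + #(E ∖ F)`, `q + 2 ≤ r` — no regime. -/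
theorem profileIneq_second_modelMatroid_all {E : Set α} (hE : E.Finite) {F : Set α} (hF : F ⊆ E) {s r : ℕ}
    (hs : 1 ≤ s) (hsF : s ≤ F.ncard) (hsr : s + 1 ≤ r) (hrm : r ≤ s + (E \ F).ncard) (q : ℕ) (hq : q + 2 ≤ r) :
    haveI := modelMatroid_finite hE F s r
    Profile.ProfileIneq (modelMatroid hE F s r) q (r - 1) := by
  classical
  haveI := modelMatroid_finite hE F s r
  by_cases hreg : r + q ≤ s + (E \ F).ncard
  · exact profileIneq_second_modelMatroid hE hF (by omega) hsF q hq hreg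
  · -- `τ := r + q − s − m ≥ 1`
    have hgr : ((gr (modelMatroid hE F s r) : Finset α) : Set α) = E := by
      rw [coe_gr, modelMatroid_E]
    have hE₁coe : (((gr (modelMatroid hE F s r)).filter (fun x => x ∈ F) : Finset α) : Set α) = F := by
      ext x
      simp only [coe_filter, Set.mem_setOf_eq]
      constructor
      · exact fun h => h.2
      · intro hx
        refine ⟨?_, hx⟩
        rw [← mem_coe, hgr]
        exact hF hx
    have hE₂coe : (((gr (modelMatroid hE F s r)).filter (fun x => x ∉ F) : Finset α) : Set α) = E \ F := by
      ext x
      simp only [coe_filter, Set.mem_setOf_eq, Set.mem_sdiff]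
      rw [← mem_coe, hgr]
    have hunion : gr (modelMatroid hE F s r) =
        (gr (modelMatroid hE F s r)).filter (fun x => x ∈ F) ∪ (gr (modelMatroid hE F s r)).filter (fun x => x ∉ F) :=
      (filter_union_filter_not_eq _ _).symm
    have hdisj : Disjoint ((gr (modelMatroid hE F s r)).filter (fun x => x ∈ F))
        ((gr (modelMatroid hE F s r)).filter (fun x => x ∉ F)) := disjoint_filter_filter_not _ _ _
    have hcard₁ : ((gr (modelMatroid hE F s r)).filter (fun x => x ∈ F)).card = F.ncard := by
      rw [← Set.ncard_coe_finset, hE₁coe]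
    have hcard₂ : ((gr (modelMatroid hE F s r)).filter (fun x => x ∉ F)).card = (E \ F).ncard := by
      rw [← Set.ncard_coe_finset, hE₂coe]
    exact profileIneq_second_uniformFlat_tau (modelMatroid hE F s r) _ _ s r hunion hdisj
      (fun X hX => modelMatroid_eRk_finset hE hF (by omega) X hX) hs (by rw [hcard₁]; exact hsF) hsr
      (by rw [hcard₂]; exact hrm) (τ := r + q - s - (E \ F).ncard) hq (by rw [hcard₂]; omega) (by omega)

/-- **C-025 AT THE CORANK-2 DIAGONAL `(r, r−2)` ON EVERY «`U_{r,n}` WITH ONE FAT FLAT `U_{s,k}`», EVERY `n`** (night-1's model,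
`1 ≤ s ≤ #F`, `s + 1 ≤ r ≤ s + #(E ∖ F)`, `2 ≤ r`). -/
theorem rls_modelMatroid_all {E : Set α} (hE : E.Finite) {F : Set α} (hF : F ⊆ E) {s r : ℕ}
    (hs : 1 ≤ s) (hsF : s ≤ F.ncard) (hsr : s + 1 ≤ r) (hrm : r ≤ s + (E \ F).ncard) (hr : 2 ≤ r) :
    haveI := modelMatroid_finite hE F s r
    ThmN.RLS (modelMatroid hE F s r) r (r - 2) := by
  haveI := modelMatroid_finite hE F s r
  apply GirthRows.rls_of_profileIneq_rows
  intro u hu1 hu2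
  have hu : u = r - 1 := by omega
  subst hu
  exact profileIneq_second_modelMatroid_all hE hF hs hsF hsr hrm (r - 2) (by omega)

end OneFlat

end PercRepro
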